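import Mathlib
import Summits.NavierStokesRegularity.NavierStokesRegularity.Theorems.EulerZoomLiouvillePowerGaugeEulerLiouvilleWeakSupportDensityLaw
import Summits.NavierStokesRegularity.NavierStokesRegularity.Theorems.EulerZoomLiouvillePowerGaugeEulerLiouvilleTransportGradientTest
import Summits.NavierStokesRegularity.NavierStokesRegularity.Theorems.EulerZoomLiouvillePowerGaugeEulerLiouvilleCondenserInfiniteType
import Literature.Analysis.FluidPDE.DecayingSelfSimilarEulerProfile
import Literature.Analysis.FunctionSpaces.SobolevDomainProofs

/-!
# NEEDLE DIGEST (C² face of `IsWeakConfinedCurl` alternative 4): a nontrivial `C²` needle has vorticity support of POSITIVE UPPER DENSITY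
# (LEAD 19832 g15; `--supports stmt-NavierStokesRegularity-19832 --as helper`)

Crux `EulerZoomLiouville.PowerGaugeEulerLiouville` (stmt-NavierStokesRegularity-19832).  Skeleton v107 wired ns-ezl-w1 g8's `WeakEulerian.supportDensityLaw` (p698147; line
`weak_eulerian` of ns-idea-11 g9, stub E3) as `IsWeakConfinedCurl ρ V` alternative 4: a weak profile whose a.e. vorticity is a RENORMALISED solution of the weak vorticity
equation (DiPerna–Lions sense; for general class members this is the line's E1 + E2, carried as hypotheses) and whose vorticity support has asymptotic density zero is trivial.
For the `C²` needle the renormalisation clause is CLASSICAL: with `G = DV`, `Ω = curl V ∈ C¹`, the tree's classical vorticity equation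
`IsSelfSimilarEulerProfile.vorticity_eq_sub_form` (`DΩ[W] = DV·Ω − Ω`, `W = γy + V`) and one integration by parts of `div(ψ·β(Ω)·W)` (`div W = 3γ`) give it for every
`β ∈ C¹` — this file proves that and draws the positive-form portrait line:

* `hasWeakFDerivOn_transport_of_contDiff` — `W = γy + V ∈ C¹` has weak gradient `γ·id + DV`;
* `integral_inner_transport_gradient` — `∫⟪W, ∇φ⟫ = −3γ∫φ` for test `φ` (`div W = 3γ`);
* `renormalisedVorticity_classical` — the renormalisation clause of alternative 4 at `G = DV` for a classical profile `IsSelfSimilarEulerProfile γ 0 V P`;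
* ★ `vorticity_support_upper_density` — crux binders verbatim, `V ∈ C²`, member NOT a.e. zero ⇒ `¬ Tendsto (R ↦ vol({curl V ≠ 0} ∩ B_R)/vol(B_R)) atTop (𝓝 0)`:
  the needle's vortical set occupies a positive fraction of large balls along a sequence `R → ∞` (every `ρ ∈ (0,½]`), while its FAST set is A-thin.

HONEST FRAMING: portrait statements about HYPOTHETICAL nontrivial members; nothing here proves or refutes the crux; 19832 OPEN; NS regularity NOT proved; not NS, not E.
[folklore (contraposition, integration by parts); DiPernaLions1989 Thm II.1 for the weak setting; ConstantinIgnatovaVicol2026Putative §3.1.1 (3.4)]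
-/

noncomputable section

open Set Filter Topology Metric Function MeasureTheory Real
open scoped RealInnerProductSpace NNReal ENNReal

set_option linter.dupNamespace false

namespace Summit.NavierStokesRegularity.NavierStokesRegularity.Theorems.PowerGaugeEulerLiouville.NeedleDigest

open Literature.Analysis Literature.Analysis.FluidPDE Literature.Analysis.FunctionSpaces
open Summit.NavierStokesRegularity.NavierStokesRegularity.Theorems.PowerGaugeEulerLiouville

variable {V : EuclideanSpace ℝ (Fin 3) → EuclideanSpace ℝ (Fin 3)}

/-- A continuous function lies in every `L^p(B(0, r))`. [folklore] -/
theorem memLp_ball_of_continuous {G : Type*} [NormedAddCommGroup G] {f : EuclideanSpace ℝ (Fin 3) → G}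
    (hf : Continuous f) (r : ℝ) (p : ℝ≥0∞) :
    MemLp f p (volume.restrict (ball (0 : EuclideanSpace ℝ (Fin 3)) r)) := by
  haveI : IsFiniteMeasure ((volume : Measure (EuclideanSpace ℝ (Fin 3))).restrict (ball (0 : EuclideanSpace ℝ (Fin 3)) r)) :=
    isFiniteMeasure_restrict.2 measure_ball_lt_top.ne
  obtain ⟨C, hC⟩ := (isCompact_closedBall (0 : EuclideanSpace ℝ (Fin 3)) r).exists_bound_of_continuousOn hf.continuousOn
  refine MemLp.of_bound hf.aestronglyMeasurable C ?_
  rw [ae_restrict_iff' measurableSet_ball]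
  exact Eventually.of_forall fun x hx => hC x (ball_subset_closedBall hx)

/-- `⟪∇φ(y), w⟫ = Dφ(y)[w]` and `⟪w, ∇φ(y)⟫ = Dφ(y)[w]`. [folklore] -/
theorem inner_gradient_eq_fderiv (φ : EuclideanSpace ℝ (Fin 3) → ℝ) (y w : EuclideanSpace ℝ (Fin 3)) :
    ⟪w, gradient φ y⟫ = fderiv ℝ φ y w := by
  rw [real_inner_comm, gradient, InnerProductSpace.toDual_symm_apply]

/-- **The transport field `W = γy + V` of a `C¹` profile has weak gradient `γ·id + DV` on `ℝ³`.** [folklore; Evans2010 §5.2.1] -/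
theorem hasWeakFDerivOn_transport_of_contDiff (hV : ContDiff ℝ 1 V) (γ : ℝ) :
    HasWeakFDerivOn (⊤ : TopologicalSpace.Opens (EuclideanSpace ℝ (Fin 3))) volume (selfSimilarTransport γ 0 V)
      (fun x => γ • ContinuousLinearMap.id ℝ (EuclideanSpace ℝ (Fin 3)) + fderiv ℝ V x) := by
  have hW : ContDiff ℝ 1 (fun y : EuclideanSpace ℝ (Fin 3) => γ • (y - 0) + V y) := ClassicalProfile.contDiff_transport hV γ 0
  have e : (fun x => γ • ContinuousLinearMap.id ℝ (EuclideanSpace ℝ (Fin 3)) + fderiv ℝ V x) =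
      fderiv ℝ (fun y : EuclideanSpace ℝ (Fin 3) => γ • (y - 0) + V y) := by
    funext x
    rw [ClassicalProfile.fderiv_transport ((hV.differentiable one_ne_zero) x) γ 0]
  have eW : selfSimilarTransport γ 0 V = fun y : EuclideanSpace ℝ (Fin 3) => γ • (y - 0) + V y := by
    funext y; rfl
  rw [e, eW]
  exact HasWeakFDerivOn.of_contDiff_holds ⊤ volume hW

/-- **`div W = 3γ` weakly**: for `V ∈ C¹` divergence-free and every test function `φ`, `∫⟪W, ∇φ⟫ = −3γ∫φ`. [folklore] -/
theorem integral_inner_transport_gradient (hV : ContDiff ℝ 1 V) (hdiv : VectorCalculus.IsDivFree V) (γ : ℝ)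
    (φ : EuclideanSpace ℝ (Fin 3) → ℝ) (hφ : IsTestFunctionOn (⊤ : TopologicalSpace.Opens (EuclideanSpace ℝ (Fin 3))) φ) :
    ∫ y, ⟪selfSimilarTransport γ 0 V y, gradient φ y⟫ = -(3 * γ) * ∫ y, φ y := by
  have hW : ContDiff ℝ 1 (fun y : EuclideanSpace ℝ (Fin 3) => γ • (y - 0) + V y) := ClassicalProfile.contDiff_transport hV γ 0
  have hdivW : ∀ y, VectorCalculus.divergence (fun y : EuclideanSpace ℝ (Fin 3) => γ • (y - 0) + V y) y = 3 * γ :=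
    fun y => ClassicalProfile.divergence_transport ((hV.differentiable one_ne_zero) y) (hdiv y) γ 0
  have h := ClassicalProfile.integral_inner_gradient_eq_of_divergence_eq_const hW hdivW
    (hφ.contDiff.of_le (mod_cast le_top)) hφ.hasCompactSupport
  have eW : (fun y => ⟪selfSimilarTransport γ 0 V y, gradient φ y⟫) =
      fun y => ⟪γ • (y - 0) + V y, gradient φ y⟫ := by funext y; rfl
  rw [eW, h]
  ring_nf

/-- **RENORMALISED VORTICITY, CLASSICAL CASE** (= the line weak_eulerian's E1 + E2 at `C²`): for a classical self-similar Euler profile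
`IsSelfSimilarEulerProfile γ 0 V P` (so `V ∈ C²`, `Ω = curl V ∈ C¹`, `DΩ[W] = DV·Ω − Ω` with `W = γy + V`, `div W = 3γ`), every `β ∈ C¹(ℝ³; ℝ)` and every test `ψ`:
`∫ β(Ω)(3γψ + Dψ[W]) = ∫ ψ · Dβ(Ω)[Ω − DV·Ω]` — one integration by parts of `div(ψ β(Ω) W)`. [folklore; ConstantinIgnatovaVicol2026Putative §3.1.1 (3.4)] -/
theorem renormalisedVorticity_classical {γ : ℝ} {P : EuclideanSpace ℝ (Fin 3) → ℝ} (hprof : IsSelfSimilarEulerProfile γ 0 V P)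
    (β : EuclideanSpace ℝ (Fin 3) → ℝ) (hβ : ContDiff ℝ 1 β)
    (ψ : EuclideanSpace ℝ (Fin 3) → ℝ) (hψ : IsTestFunctionOn (⊤ : TopologicalSpace.Opens (EuclideanSpace ℝ (Fin 3))) ψ) :
    ∫ y, β (curl V y) * (3 * γ * ψ y + fderiv ℝ ψ y (selfSimilarTransport γ 0 V y)) =
      ∫ y, ψ y * fderiv ℝ β (curl V y) (curl V y - fderiv ℝ V y (curl V y)) := by
  have hV : ContDiff ℝ 2 V := hprof.contDiff_velocity
  have hV1 : ContDiff ℝ 1 V := hV.of_le one_le_two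
  have hΩ : ContDiff ℝ 1 (curl V) := by
    have e : curl V = fun y => curlCLM (fderiv ℝ V y) := rfl
    rw [e]
    exact curlCLM.contDiff.comp (hV.fderiv_right (m := 1) le_rfl)
  have hψ1 : ContDiff ℝ 1 ψ := hψ.contDiff.of_le (mod_cast le_top)
  have hψc : HasCompactSupport ψ := hψ.hasCompactSupport
  have hW : ContDiff ℝ 1 (fun y : EuclideanSpace ℝ (Fin 3) => γ • (y - 0) + V y) := ClassicalProfile.contDiff_transport hV1 γ 0
  have hdivW : ∀ y, VectorCalculus.divergence (fun y : EuclideanSpace ℝ (Fin 3) => γ • (y - 0) + V y) y = 3 * γ :=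
    fun y => ClassicalProfile.divergence_transport ((hV1.differentiable one_ne_zero) y) (hprof.divFree y) γ 0
  -- the scalar `θ = ψ · β∘Ω ∈ C¹_c`
  set θ : EuclideanSpace ℝ (Fin 3) → ℝ := fun y => ψ y * β (curl V y) with hθdef
  have hθ : ContDiff ℝ 1 θ := hψ1.mul (hβ.comp hΩ)
  have hθc : HasCompactSupport θ := hψc.mul_right
  -- IBP: `∫⟪W, ∇θ⟫ = −3γ ∫ θ`
  have hIBP := ClassicalProfile.integral_inner_gradient_eq_of_divergence_eq_const hW hdivW hθ hθc
  -- the derivative of `θ` along `W`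
  have hDθ : ∀ y, fderiv ℝ θ y (γ • (y - 0) + V y) =
      β (curl V y) * fderiv ℝ ψ y (γ • (y - 0) + V y) +
        ψ y * fderiv ℝ β (curl V y) (fderiv ℝ (curl V) y (γ • (y - 0) + V y)) := by
    intro y
    have h1 : HasFDerivAt ψ (fderiv ℝ ψ y) y := ((hψ1.differentiable one_ne_zero) y).hasFDerivAt
    have h2 : HasFDerivAt (fun y => β (curl V y)) ((fderiv ℝ β (curl V y)).comp (fderiv ℝ (curl V) y)) y :=
      ((hβ.differentiable one_ne_zero) (curl V y)).hasFDerivAt.comp y ((hΩ.differentiable one_ne_zero) y).hasFDerivAt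
    have hθy : HasFDerivAt θ (ψ y • ((fderiv ℝ β (curl V y)).comp (fderiv ℝ (curl V) y)) +
        β (curl V y) • fderiv ℝ ψ y) y := h1.mul h2
    rw [hθy.fderiv]
    simp only [add_apply, smul_apply, ContinuousLinearMap.coe_comp, Function.comp_apply, smul_eq_mul]
    ring
  -- the classical vorticity equation `DΩ[W] = DV·Ω − Ω`
  have hvort : ∀ y, fderiv ℝ (curl V) y (γ • (y - 0) + V y) = fderiv ℝ V y (curl V y) - curl V y := by
    intro y
    have e := hprof.vorticity_eq_sub_form y
    rw [sub_eq_iff_eq_add] at e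
    rw [e]
    abel
  -- pointwise: `⟪W, ∇θ⟫ = β(Ω) Dψ[W] − ψ Dβ(Ω)[Ω − DV·Ω]`
  have hpt : ∀ y, ⟪γ • (y - 0) + V y, gradient θ y⟫ =
      β (curl V y) * fderiv ℝ ψ y (selfSimilarTransport γ 0 V y) -
        ψ y * fderiv ℝ β (curl V y) (curl V y - fderiv ℝ V y (curl V y)) := by
    intro y
    rw [inner_gradient_eq_fderiv, hDθ y, hvort y, selfSimilarTransport_apply]
    have hlin : fderiv ℝ β (curl V y) (fderiv ℝ V y (curl V y) - curl V y) =
        -fderiv ℝ β (curl V y) (curl V y - fderiv ℝ V y (curl V y)) := by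
      rw [← map_neg, neg_sub]
    rw [hlin]
    ring
  -- integrability of the two pieces (compact support from `ψ`)
  have hcA : Continuous fun y => β (curl V y) * fderiv ℝ ψ y (selfSimilarTransport γ 0 V y) := by
    refine (hβ.continuous.comp hΩ.continuous).mul ?_
    exact ((hψ1.continuous_fderiv one_ne_zero).clm_apply (hW.continuous.congr fun y => by rfl))
  have hcB : Continuous fun y => ψ y * fderiv ℝ β (curl V y) (curl V y - fderiv ℝ V y (curl V y)) := by
    refine hψ1.continuous.mul ?_
    exact ((hβ.continuous_fderiv one_ne_zero).comp hΩ.continuous).clm_apply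
      (hΩ.continuous.sub ((hV1.continuous_fderiv one_ne_zero).clm_apply hΩ.continuous))
  have hiA : Integrable (fun y => β (curl V y) * fderiv ℝ ψ y (selfSimilarTransport γ 0 V y)) := by
    refine hcA.integrable_of_hasCompactSupport ?_
    refine (hψc.fderiv (𝕜 := ℝ)).mono fun y hy => ?_
    contrapose! hy
    simp only [Function.mem_support, ne_eq, not_not] at hy ⊢
    rw [hy]; simp
  have hiB : Integrable (fun y => ψ y * fderiv ℝ β (curl V y) (curl V y - fderiv ℝ V y (curl V y))) :=
    hcB.integrable_of_hasCompactSupport hψc.mul_right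
  have hiC : Integrable (fun y => β (curl V y) * (3 * γ * ψ y)) :=
    ((hβ.continuous.comp hΩ.continuous).mul (continuous_const.mul hψ1.continuous)).integrable_of_hasCompactSupport
      hψc.mul_left.mul_left
  -- assemble
  have hI : ∫ y, ⟪γ • (y - 0) + V y, gradient θ y⟫ =
      (∫ y, β (curl V y) * fderiv ℝ ψ y (selfSimilarTransport γ 0 V y)) -
        ∫ y, ψ y * fderiv ℝ β (curl V y) (curl V y - fderiv ℝ V y (curl V y)) := by
    rw [← integral_sub hiA hiB]
    exact integral_congr_ae (Eventually.of_forall hpt)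
  have hθI : ∫ y, θ y = ∫ y, ψ y * β (curl V y) := rfl
  rw [hI, hθI] at hIBP
  have hsplit : ∫ y, β (curl V y) * (3 * γ * ψ y + fderiv ℝ ψ y (selfSimilarTransport γ 0 V y)) =
      (∫ y, β (curl V y) * (3 * γ * ψ y)) + ∫ y, β (curl V y) * fderiv ℝ ψ y (selfSimilarTransport γ 0 V y) := by
    rw [← integral_add hiC hiA]
    exact integral_congr_ae (Eventually.of_forall fun y => by ring)
  have hC : ∫ y, β (curl V y) * (3 * γ * ψ y) = 3 * γ * ∫ y, ψ y * β (curl V y) := by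
    rw [← integral_const_mul]
    exact integral_congr_ae (Eventually.of_forall fun y => by ring)
  rw [hsplit, hC]
  linarith

/-- **A NONTRIVIAL `C²` NEEDLE HAS VORTICITY SUPPORT OF POSITIVE UPPER DENSITY** (the `C²` face of `IsWeakConfinedCurl` alternative 4, skeleton v107).
Crux binders verbatim, `0 < ρ ≤ ½`, exact self-similarity about the origin, `V ∈ C²`, member NOT a.e. zero ⇒ the density `vol({curl V ≠ 0} ∩ B_R)/vol(B_R)` does
NOT tend to `0`: the vortical cells occupy a positive fraction of large balls along a sequence `R → ∞`.  Contrapositive of ns-ezl-w1 g8's `WeakEulerian.supportDensityLaw`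
(p698147) at `G = DV`, the renormalisation clause being `renormalisedVorticity_classical` for a classical pressure of the profile
(`WeakToClassical.exists_isSelfSimilarEulerProfile_of_contDiff`). [folklore; DiPernaLions1989 Thm II.1] -/
theorem vorticity_support_upper_density {ρ : ℝ} (hρ : 0 < ρ) (hρ1 : ρ ≤ 1 / 2)
    {u : ℝ → EuclideanSpace ℝ (Fin 3) → EuclideanSpace ℝ (Fin 3)} {p : ℝ → EuclideanSpace ℝ (Fin 3) → ℝ}
    {H : ℝ → EuclideanSpace ℝ (Fin 3) → EuclideanSpace ℝ (Fin 3) →L[ℝ] EuclideanSpace ℝ (Fin 3)} {c : ℝ≥0}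
    (hsw : IsSuitableWeakSolutionOn (slab (EuclideanSpace ℝ (Fin 3)) (Iio 0) isOpen_Iio) 0 0 u p)
    (hH : HasWeakSpatialGradientOn (slab (EuclideanSpace ℝ (Fin 3)) (Iio 0) isOpen_Iio) u H)
    (hgauge : ∀ a : ℝ, 0 < a →
      ENNReal.ofReal (a ^ (2 * ρ)) * cknA a (0 : ℝ × EuclideanSpace ℝ (Fin 3)) u +
          ENNReal.ofReal (a ^ ρ) * cknE a (0 : ℝ × EuclideanSpace ℝ (Fin 3)) H +
        ENNReal.ofReal (a ^ (2 * ρ)) * cknD a (0 : ℝ × EuclideanSpace ℝ (Fin 3)) p ≤ (c : ℝ≥0∞))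
    {P : EuclideanSpace ℝ (Fin 3) → ℝ}
    (hu : ∀ τ : ℝ, τ < 0 → u τ = selfSimilarCollapse (1 / (2 + ρ)) 0 V τ)
    (hp : ∀ τ : ℝ, τ < 0 → p τ = selfSimilarCollapsePressure (1 / (2 + ρ)) 0 P τ)
    (hV : ContDiff ℝ 2 V)
    (hnt : ¬ (uncurry u =ᵐ[volume.restrict (Iio (0 : ℝ) ×ˢ (univ : Set (EuclideanSpace ℝ (Fin 3))))] 0)) :
    ¬ Tendsto (fun R : ℝ => (volume : Measure (EuclideanSpace ℝ (Fin 3)))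
        ({y : EuclideanSpace ℝ (Fin 3) | curl V y ≠ 0} ∩ ball (0 : EuclideanSpace ℝ (Fin 3)) R) /
          (volume : Measure (EuclideanSpace ℝ (Fin 3))) (ball (0 : EuclideanSpace ℝ (Fin 3)) R)) atTop (𝓝 0) := by
  intro hΘ
  have hρ1' : ρ < 1 := by linarith
  have hV1 : ContDiff ℝ 1 V := hV.of_le one_le_two
  -- ### a classical pressure for the profile (as in `Condenser.selfSimilar_ae_eq_zero_of_finiteTypeGradientC2`)
  have hD : ∀ a : ℝ, 0 < a → ENNReal.ofReal (a ^ (2 * ρ)) *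
      cknD a (0 : ℝ × EuclideanSpace ℝ (Fin 3)) p ≤ (c : ℝ≥0∞) :=
    fun a ha => le_trans le_add_self (hgauge a ha)
  have hpm : AEStronglyMeasurable (uncurry p)
      (volume.restrict (Iio (0 : ℝ) ×ˢ (univ : Set (EuclideanSpace ℝ (Fin 3))))) := by
    have := hsw.distributional.2.2.1.aestronglyMeasurable
    simpa [slab] using this
  have hPm := aestronglyMeasurable_pressureProfile hpm hp
  have hDprof := profile_pressure_weight_of_gaugeD hρ hρ1' hpm hp hD
  have hP1 : LocallyIntegrable P volume :=
    EnergySaturation.locallyIntegrable_pressure_of_weight hρ1' hPm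
      (ENNReal.mul_ne_top ENNReal.ofReal_ne_top ENNReal.coe_ne_top) hDprof
  obtain ⟨P', hprof⟩ :=
    WeakToClassical.exists_isSelfSimilarEulerProfile_of_contDiff hsw.distributional hu hp hV hP1
  -- ### the clauses of alternative 4 at `G = DV`
  have hcurl : ∀ y, curlCLM (fderiv ℝ V y) = curl V y := fun y => rfl
  have hPG : HasWeakFDerivOn (⊤ : TopologicalSpace.Opens (EuclideanSpace ℝ (Fin 3))) volume V (fderiv ℝ V) ∧
      (∀ r : ℝ, MemLp (fderiv ℝ V) 2 (volume.restrict (ball (0 : EuclideanSpace ℝ (Fin 3)) r))) ∧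
      (∀ r : ℝ, MemLp V 6 (volume.restrict (ball (0 : EuclideanSpace ℝ (Fin 3)) r))) ∧
      HasWeakFDerivOn (⊤ : TopologicalSpace.Opens (EuclideanSpace ℝ (Fin 3))) volume (selfSimilarTransport (1 / (2 + ρ)) 0 V)
        (fun x => (1 / (2 + ρ)) • ContinuousLinearMap.id ℝ (EuclideanSpace ℝ (Fin 3)) + fderiv ℝ V x) :=
    ⟨HasWeakFDerivOn.of_contDiff_holds ⊤ volume hV1,
      fun r => memLp_ball_of_continuous (hV.continuous_fderiv (by norm_num)) r 2,
      fun r => memLp_ball_of_continuous hV.continuous r 6,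
      hasWeakFDerivOn_transport_of_contDiff hV1 (1 / (2 + ρ))⟩
  have hdiv : ∀ φ : EuclideanSpace ℝ (Fin 3) → ℝ, IsTestFunctionOn (⊤ : TopologicalSpace.Opens (EuclideanSpace ℝ (Fin 3))) φ →
      ∫ y, inner ℝ (selfSimilarTransport (1 / (2 + ρ)) 0 V y) (gradient φ y) = -(3 * (1 / (2 + ρ))) * ∫ y, φ y :=
    fun φ hφ => integral_inner_transport_gradient hV1 hprof.divFree (1 / (2 + ρ)) φ hφ
  have hren : ∀ β : EuclideanSpace ℝ (Fin 3) → ℝ, ContDiff ℝ 1 β →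
      (∃ C : ℝ, ∀ w : EuclideanSpace ℝ (Fin 3), ‖β w‖ ≤ C ∧ ‖fderiv ℝ β w‖ ≤ C) →
      ∀ ψ : EuclideanSpace ℝ (Fin 3) → ℝ, IsTestFunctionOn (⊤ : TopologicalSpace.Opens (EuclideanSpace ℝ (Fin 3))) ψ →
        ∫ y, β (curlCLM (fderiv ℝ V y)) * (3 * (1 / (2 + ρ)) * ψ y + fderiv ℝ ψ y (selfSimilarTransport (1 / (2 + ρ)) 0 V y)) =
          ∫ y, ψ y * fderiv ℝ β (curlCLM (fderiv ℝ V y))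
            (curlCLM (fderiv ℝ V y) - fderiv ℝ V y (curlCLM (fderiv ℝ V y))) := by
    intro β hβ _ ψ hψ
    simp only [hcurl]
    exact renormalisedVorticity_classical hprof β hβ ψ hψ
  have hΘ' : Tendsto (fun R : ℝ => (volume : Measure (EuclideanSpace ℝ (Fin 3)))
      ({y : EuclideanSpace ℝ (Fin 3) | curlCLM (fderiv ℝ V y) ≠ 0} ∩ ball (0 : EuclideanSpace ℝ (Fin 3)) R) /
        (volume : Measure (EuclideanSpace ℝ (Fin 3))) (ball (0 : EuclideanSpace ℝ (Fin 3)) R)) atTop (𝓝 0) := by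
    simp only [hcurl]; exact hΘ
  exact hnt (WeakEulerian.supportDensityLaw hρ hρ1 ⟨hsw, hH, hgauge⟩ ⟨hu, hp⟩ hPG hdiv hren hΘ')

end Summit.NavierStokesRegularity.NavierStokesRegularity.Theorems.PowerGaugeEulerLiouville.NeedleDigest

end
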